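import Summits.Ventures.DiscreteObjects.PP12.OrderElevenTriangleKernel
import Summits.Ventures.DiscreteObjects.PP12.OrderElevenTriangleTableA
import Summits.Ventures.DiscreteObjects.PP12.OrderElevenTriangleRowsA

/-!
# PP(12), order-11 cell, Case B (`NoTriangleData12`): kernel RUNS — walker equations, part A (designs g23)
Framing: lottery ticket; floor = certified bounds/negative ranges.

Cell pub-namedobj (venture DiscreteObjects), target (M). The partition walker reproduces the literal table `PARTS` and the label walker reproduces the literal candidate-row tables `ROWSk` of the orbit representatives `REPS[k]` (this part: `partsEnum = PARTS` and `k = 0, 1, 2`).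
Every declaration is closed by `decide +kernel` (kernel shape measured by designs g23: a row walk ≈ 40 s, a scan slice ≤ 5 s, a φ-walk slice ≈ 3 s).
Exact Python mirror of every function and table: pub-namedobj-designs-g23/code/caseB/tri12k.py (all statements below are `True` there too).
No `sorry`, no axioms beyond the standard three; nothing here asserts a census statement by itself.
-/

namespace Summit.Ventures.DiscreteObjects.PP12

namespace Triangle12

set_option maxHeartbeats 400000000 in
/-- the partition walker enumerates exactly the 545 literal partitions `PARTS` (in order) -/
theorem partsEnum_eq : partsEnum = PARTS := by decide +kernel

set_option maxHeartbeats 400000000 in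
/-- the candidate rows of representative `0` (`φ = 0x12459638a70`, 148 rows) are exactly `ROWS0` -/
theorem rows_eq_0 : rowsFrom 0x12459638a70 PARTS = ROWS0 := by decide +kernel

set_option maxHeartbeats 400000000 in
/-- the candidate rows of representative `1` (`φ = 0x135648a7920`, 120 rows) are exactly `ROWS1` -/
theorem rows_eq_1 : rowsFrom 0x135648a7920 PARTS = ROWS1 := by decide +kernel

set_option maxHeartbeats 400000000 in
/-- the candidate rows of representative `2` (`φ = 0x125a4638970`, 88 rows) are exactly `ROWS2` -/
theorem rows_eq_2 : rowsFrom 0x125a4638970 PARTS = ROWS2 := by decide +kernel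

end Triangle12

end Summit.Ventures.DiscreteObjects.PP12
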